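import Summits.Ventures.PercRepro.CorePlanes
import Summits.Ventures.PercRepro.CoreFiveSmall

/-!
# PercRepro — the corank-`6` core cells `10 ≤ p ≤ 12` (p2, gen 12)

The method of `CoreFiveSmall` at corank `6` (`n = |E| = p + 6 ∈ [16, 18]`) with the plane count of `CorePlanes`
(`7·A ≤ 29·s₄`, `A = #{sets of rank ≤ 3 with ≥ 5 points}`) on both sides: `ν(S₀) ≤ 5` (`rls_six_of_nullity_le_five`:
`s₃ ≤ 25`, `s₄ ≤ 70` by night-1's counts at nullity `≤ 5`; ratios `0.74, 0.63, 0.54`) and `ν(S₀) = 6` (`rls_six_of_dense`: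
`S₀ = E`, series classes of `≤ 4` elements, the class-structure bounds and the cocircuit count with the exact number of
classes at nullity `6`, `s₃ ≤ 36`; every class-size vector passes `table_dense6_16` … `table_dense6_18`, worst `0.909`).
* `topCount_le_general` (`#U(p,3) ≤ C(n,3) + #{4-sets of rank ≤ 3} + A` at any corank), `cellOK6`, `cellOK6_spec`, **`rls_of_cellOK6`**,
  **`c025_core_six`**, `SmallCoreCellsSeven`, **`c025_three_of_smallCoreCellsSeven`**. Imports `CorePlanes`, `CoreFiveSmall`. Axioms: standard.
-/

namespace PercRepro
namespace CoreFour

open Finset Set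

variable {α : Type} {M : Matroid α}

/-- **`#U(p,3)` at any corank**: the rank-`3` side of a `U`-partition has `3` points, is a `4`-set of rank `≤ 3`, or has `≥ 5`. -/
theorem topCount_le_general [M.Finite] (p : ℕ) :
    Matroid.topCount M p 3 ≤ M.E.ncard.choose 3 + {B : Set α | B ⊆ M.E ∧ B.ncard = 4 ∧ M.eRk B ≤ 3}.ncard +
      {B : Set α | B ⊆ M.E ∧ M.eRk B ≤ 3 ∧ 5 ≤ B.ncard}.ncard := by
  classical
  have hE : (M.ground_finite.toFinset : Set α) = M.E := Set.Finite.coe_toFinset _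
  have hinj : Set.InjOn (fun A : Set α => M.E \ A)
      {A : Set α | A ⊆ M.E ∧ M.eRk A = (p : ℕ∞) ∧ M.eRk (M.E \ A) = ((3 : ℕ) : ℕ∞)} := by
    intro X hX Y hY hXY
    simp only at hXY
    rw [← Set.sdiff_sdiff_cancel_left hX.1, hXY, Set.sdiff_sdiff_cancel_left hY.1]
  have hmaps : ∀ A ∈ {A : Set α | A ⊆ M.E ∧ M.eRk A = (p : ℕ∞) ∧ M.eRk (M.E \ A) = ((3 : ℕ) : ℕ∞)},
      (fun A : Set α => M.E \ A) A ∈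
        ({B : Set α | B ⊆ (M.ground_finite.toFinset : Set α) ∧ B.ncard = 3} ∪
          {B : Set α | B ⊆ M.E ∧ B.ncard = 4 ∧ M.eRk B ≤ 3}) ∪
          {B : Set α | B ⊆ M.E ∧ M.eRk B ≤ 3 ∧ 5 ≤ B.ncard} := by
    rintro A ⟨hAE, _, hBr⟩
    simp only
    have hBE : M.E \ A ⊆ M.E := Set.sdiff_subset
    have hBfin : (M.E \ A).Finite := M.ground_finite.subset hBE
    have h3 : ((3 : ℕ) : ℕ∞) ≤ (M.E \ A).encard := by rw [← hBr]; exact M.eRk_le_encard _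
    rw [← hBfin.cast_ncard_eq] at h3
    have h3' : 3 ≤ (M.E \ A).ncard := by exact_mod_cast h3
    have hBr3 : M.eRk (M.E \ A) ≤ 3 := by rw [hBr]; exact_mod_cast le_refl (3 : ℕ)
    rcases Nat.lt_or_ge (M.E \ A).ncard 4 with hlt | hge
    · exact Or.inl (Or.inl ⟨by rw [hE]; exact hBE, by omega⟩)
    rcases Nat.lt_or_ge (M.E \ A).ncard 5 with hlt5 | hge5
    · exact Or.inl (Or.inr ⟨hBE, by omega, hBr3⟩)
    · exact Or.inr ⟨hBE, hBr3, hge5⟩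
  have hfin : (({B : Set α | B ⊆ (M.ground_finite.toFinset : Set α) ∧ B.ncard = 3} ∪
        {B : Set α | B ⊆ M.E ∧ B.ncard = 4 ∧ M.eRk B ≤ 3}) ∪
        {B : Set α | B ⊆ M.E ∧ M.eRk B ≤ 3 ∧ 5 ≤ B.ncard}).Finite :=
    (((M.ground_finite.toFinset.finite_toSet.finite_subsets).subset (fun X hX => hX.1)).union
      (M.ground_finite.finite_subsets.subset (fun X hX => hX.1))).union
      (M.ground_finite.finite_subsets.subset (fun X hX => hX.1))
  have hcard : M.ground_finite.toFinset.card = M.E.ncard := (Set.ncard_eq_toFinset_card _ _).symm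
  calc Matroid.topCount M p 3
      = {A : Set α | A ⊆ M.E ∧ M.eRk A = (p : ℕ∞) ∧ M.eRk (M.E \ A) = ((3 : ℕ) : ℕ∞)}.ncard := rfl
    _ ≤ _ := Set.ncard_le_ncard_of_injOn _ hmaps hinj hfin
    _ ≤ ({B : Set α | B ⊆ (M.ground_finite.toFinset : Set α) ∧ B.ncard = 3}.ncard +
          {B : Set α | B ⊆ M.E ∧ B.ncard = 4 ∧ M.eRk B ≤ 3}.ncard) +
          {B : Set α | B ⊆ M.E ∧ M.eRk B ≤ 3 ∧ 5 ≤ B.ncard}.ncard := by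
        refine (Set.ncard_union_le _ _).trans ?_
        gcongr
        exact Set.ncard_union_le _ _
    _ = _ := by rw [ncard_subsets_ncard_eq, hcard]
/-! ### The cell predicate at corank `6` -/

/-- The corank-`6` cell at `n = |E|` with bounds `s₃`, `s₄`: `A := 29·s₄/7` bounds the sets of rank `≤ 3` with `≥ 5`
points; `U = C(n,3) + s₃(n−3) + s₄ + A`, `R = Σ_{j<4} C(n,j) + s₃(n−3) + s₄ + A`, `S = Σ_{j<7} C(n,j)`, `p = n − 6`. -/
def cellOK6 (n s₃ s₄ : ℕ) : Bool :=
  let p := n - 6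
  let phiNum := 2 ^ (p + 3) - 2 * ∑ u ∈ range 4, CoreRegimes.chooseF (p + 3) u
  let phiDen := CoreRegimes.chooseF (p + 3) 3
  let A := 29 * s₄ / 7
  let U := CoreRegimes.chooseF n 3 + (s₃ * (n - 3) + s₄) + A
  let R := (∑ j ∈ range 4, CoreRegimes.chooseF n j) + (s₃ * (n - 3) + s₄) + A
  let S := ∑ j ∈ range 7, CoreRegimes.chooseF n j
  decide (phiNum * U + phiDen * (R + S) ≤ phiDen * 2 ^ n)

/-- What `cellOK6 n s₃ s₄ = true` says, as an inequality in `ℕ` (with `A = 29·s₄/7`). -/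
theorem cellOK6_spec {n s₃ s₄ : ℕ} (h : cellOK6 n s₃ s₄ = true) :
    (2 ^ (n - 6 + 3) - 2 * ∑ u ∈ range 4, Nat.choose (n - 6 + 3) u) *
        (n.choose 3 + (s₃ * (n - 3) + s₄) + 29 * s₄ / 7) +
      Nat.choose (n - 6 + 3) 3 * (((∑ j ∈ range 4, n.choose j) + (s₃ * (n - 3) + s₄) + 29 * s₄ / 7) +
        ∑ j ∈ range 7, n.choose j) ≤ Nat.choose (n - 6 + 3) 3 * 2 ^ n := by
  unfold cellOK6 at h
  simp only [CoreRegimes.chooseF_eq] at h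
  exact of_decide_eq_true h

/-- **A kernel-evaluated corank-`6` cell gives C-025 at `(p, 3)`** on the core with (C1), (C2), `p ≥ 9`, `|E| = p + 6`,
`#{3-circuits} ≤ s₃`, `#{4-circuits} ≤ s₄`. -/
theorem rls_of_cellOK6 (M : Matroid α) [M.Finite] (p : ℕ) (hp : 9 ≤ p)
    (hs : ∀ e ∈ M.E, ∀ f ∈ M.E, e ≠ f → M.eRk {e, f} = 2)
    (hC1 : ∀ L ⊆ M.E, M.eRk L = 2 → L.ncard ≤ 3) (hC2 : ∀ P ⊆ M.E, M.eRk P = 3 → P.ncard ≤ 7)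
    (hrank : M.eRank = (p : ℕ∞)) (hE : M.E.ncard = p + 6)
    {s₃ s₄ : ℕ} (hs₃ : (PercRepro.Matroid.circuitsEq M 3).ncard ≤ s₃)
    (hs₄ : (PercRepro.Matroid.circuitsEq M 4).ncard ≤ s₄)
    (hcell : cellOK6 (p + 6) s₃ s₄ = true) : ThmN.RLS M p 3 := by
  classical
  have hEcard : M.ground_finite.toFinset.card = p + 6 := by
    rw [← hE, Set.ncard_eq_toFinset_card _ M.ground_finite]
  have hd : M.E.encard = M.eRank + 6 := by
    rw [hrank, ← M.ground_finite.cast_ncard_eq, hE]; push_cast; rfl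
  have hrank2 : 2 ≤ M.eRank := by rw [hrank]; exact_mod_cast (show 2 ≤ p by omega)
  have h4 : {X : Set α | X ⊆ M.E ∧ X.ncard = 4 ∧ M.eRk X ≤ 3}.ncard ≤ s₃ * (p + 6 - 3) + s₄ := by
    have h := ncard_four_sets_le hs hrank2
    rw [hE] at h
    have h' : (PercRepro.Matroid.circuitsEq M 3).ncard * (p + 6 - 3) ≤ s₃ * (p + 6 - 3) :=
      Nat.mul_le_mul_right _ hs₃
    omega
  have hbig : {X : Set α | X ⊆ M.E ∧ M.eRk X ≤ 3 ∧ 5 ≤ X.ncard}.ncard ≤ 29 * s₄ / 7 := by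
    have h := seven_mul_ncard_big_sets_le hs hC1 hC2
    rw [Nat.le_div_iff_mul_le (by norm_num)]
    have h' : 29 * (PercRepro.Matroid.circuitsEq M 4).ncard ≤ 29 * s₄ := Nat.mul_le_mul_left _ hs₄
    omega
  have hU : Matroid.topCount M p 3 ≤ (p + 6).choose 3 + (s₃ * (p + 6 - 3) + s₄) + 29 * s₄ / 7 := by
    have h := topCount_le_general (M := M) p
    rw [hE] at h
    omega
  have hR : {X : Set α | X ⊆ M.E ∧ M.eRk X ≤ 3}.ncard ≤
      (∑ j ∈ range 4, (p + 6).choose j) + (s₃ * (p + 6 - 3) + s₄) + 29 * s₄ / 7 := by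
    have h := ncard_eRk_le_three_le_general (M := M)
    rw [hE] at h
    omega
  have hS : {X : Set α | X ⊆ M.E ∧ M.eRk X = M.eRank}.ncard ≤ ∑ j ∈ range 7, (p + 6).choose j := by
    have h := PercRepro.Matroid.ncard_spanning_le (M := M) (d := 6) hd
    rw [hEcard] at h
    exact h
  have hY : 2 ^ (p + 6) ≤ Matroid.midCount M p 3 + {X : Set α | X ⊆ M.E ∧ M.eRk X ≤ 3}.ncard +
      {X : Set α | X ⊆ M.E ∧ M.eRk X = M.eRank}.ncard := by
    have h := PercRepro.Matroid.two_pow_le_midCount_add (M := M) p 3 hrank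
    rw [hEcard] at h
    exact h
  have hcell' := cellOK6_spec hcell
  rw [Nat.add_sub_cancel] at hcell'
  obtain ⟨phiNum, hphiNum⟩ : ∃ x, x = 2 ^ (p + 3) - 2 * ∑ u ∈ range 4, Nat.choose (p + 3) u := ⟨_, rfl⟩
  obtain ⟨phiDen, hphiDen⟩ : ∃ x, x = Nat.choose (p + 3) 3 := ⟨_, rfl⟩
  obtain ⟨U, hU_def⟩ : ∃ x, x = (p + 6).choose 3 + (s₃ * (p + 6 - 3) + s₄) + 29 * s₄ / 7 := ⟨_, rfl⟩
  obtain ⟨R, hR_def⟩ : ∃ x, x = (∑ j ∈ range 4, (p + 6).choose j) + (s₃ * (p + 6 - 3) + s₄) + 29 * s₄ / 7 :=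
    ⟨_, rfl⟩
  obtain ⟨S, hS_def⟩ : ∃ x, x = ∑ j ∈ range 7, (p + 6).choose j := ⟨_, rfl⟩
  rw [← hphiNum, ← hphiDen, ← hU_def, ← hR_def, ← hS_def] at hcell'
  rw [← hU_def] at hU
  rw [← hR_def] at hR
  rw [← hS_def] at hS
  have hUq : (Matroid.topCount M p 3 : ℚ) ≤ (U : ℚ) := by exact_mod_cast hU
  have hRq : ({X : Set α | X ⊆ M.E ∧ M.eRk X ≤ 3}.ncard : ℚ) ≤ (R : ℚ) := by exact_mod_cast hR
  have hSq : ({X : Set α | X ⊆ M.E ∧ M.eRk X = M.eRank}.ncard : ℚ) ≤ (S : ℚ) := by exact_mod_cast hS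
  have hYq : ((2 : ℕ) ^ (p + 6) : ℚ) ≤ (Matroid.midCount M p 3 : ℚ) +
      ({X : Set α | X ⊆ M.E ∧ M.eRk X ≤ 3}.ncard : ℚ) +
      ({X : Set α | X ⊆ M.E ∧ M.eRk X = M.eRank}.ncard : ℚ) := by exact_mod_cast hY
  have hcellq : (phiNum : ℚ) * (U : ℚ) + (phiDen : ℚ) * ((R : ℚ) + (S : ℚ)) ≤
      (phiDen : ℚ) * ((2 : ℕ) ^ (p + 6) : ℚ) := by exact_mod_cast hcell'
  have hsub : 2 * ∑ u ∈ range 4, Nat.choose (p + 3) u ≤ 2 ^ (p + 3) := by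
    have := CoreRegimes.sum_Ioo_choose_add p (by omega); omega
  have hphi : phiK p 3 * (phiDen : ℚ) = (phiNum : ℚ) := by
    rw [hphiNum, Nat.cast_sub hsub, hphiDen]
    push_cast
    exact CoreRegimes.phiK_three_mul_choose_eq p (by omega)
  have hDpos : (0 : ℚ) < (phiDen : ℚ) := by
    rw [hphiDen]; exact_mod_cast Nat.choose_pos (by omega)
  have hNnn : (0 : ℚ) ≤ (phiNum : ℚ) := by positivity
  have h1 : (phiNum : ℚ) * (Matroid.topCount M p 3 : ℚ) ≤ (phiNum : ℚ) * (U : ℚ) :=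
    mul_le_mul_of_nonneg_left hUq hNnn
  have h2 : (phiDen : ℚ) * ((2 : ℕ) ^ (p + 6) : ℚ) ≤
      (phiDen : ℚ) * ((Matroid.midCount M p 3 : ℚ) + (R : ℚ) + (S : ℚ)) :=
    mul_le_mul_of_nonneg_left (by linarith) hDpos.le
  have hkey : (phiNum : ℚ) * (Matroid.topCount M p 3 : ℚ) ≤ (phiDen : ℚ) * (Matroid.midCount M p 3 : ℚ) := by
    have h2' := h2
    rw [mul_add, mul_add] at h2'
    have hc' := hcellq
    rw [mul_add] at hc'
    have hUmid : (phiNum : ℚ) * (U : ℚ) ≤ (phiDen : ℚ) * (Matroid.midCount M p 3 : ℚ) := by linarith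
    linarith
  rw [ThmN.RLS_iff]
  rw [← hphi] at hkey
  have : phiK p 3 * (Matroid.topCount M p 3 : ℚ) * (phiDen : ℚ) ≤ (Matroid.midCount M p 3 : ℚ) * (phiDen : ℚ) := by
    calc phiK p 3 * (Matroid.topCount M p 3 : ℚ) * (phiDen : ℚ)
        = phiK p 3 * (phiDen : ℚ) * (Matroid.topCount M p 3 : ℚ) := by ring
      _ ≤ (phiDen : ℚ) * (Matroid.midCount M p 3 : ℚ) := hkey
      _ = (Matroid.midCount M p 3 : ℚ) * (phiDen : ℚ) := by ring
  exact le_of_mul_le_mul_right this hDpos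
/-! ### Case A: `ν(S₀) ≤ 5` -/

/-- The sparse case at corank `6` (`ν(S₀) ≤ 5`): the cell with `s₃ ≤ 25`, `s₄ ≤ 70`, `16 ≤ n ≤ 18` (`decide +kernel`). -/
theorem table_sparse6 : ∀ n < 19, 16 ≤ n → cellOK6 n 25 70 = true := by
  decide +kernel

/-- **Case A at corank `6`**: `ν(S₀) ≤ 5` — `s₃ ≤ 25`, `s₄ ≤ 70` by the counts at nullity `≤ 5`, then `table_sparse6`. -/
theorem rls_six_of_nullity_le_five (M : Matroid α) [M.Finite] (p : ℕ) (hp : 10 ≤ p) (hp' : p ≤ 12)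
    (hs : ∀ e ∈ M.E, ∀ f ∈ M.E, e ≠ f → M.eRk {e, f} = 2)
    (hfree : ∀ e ∈ M.E, ∃ A ⊆ M.E \ {e}, e ∉ M.closure A ∧ e ∉ M.closure ((M.E \ {e}) \ A))
    (hrank : M.eRank = (p : ℕ∞)) (hE : M.E.ncard = p + 6)
    {d' : ℕ} (hd' : (⋃₀ PercRepro.Matroid.circuitsLE M 4).encard = M.eRk (⋃₀ PercRepro.Matroid.circuitsLE M 4) + d')
    (hd5 : d' ≤ 5) : ThmN.RLS M p 3 := by
  have hC1 : ∀ L ⊆ M.E, M.eRk L = 2 → L.ncard ≤ 3 :=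
    fun L hL hr => ThmN.ncard_le_three_of_eRk_two M hs hfree hL hr
  have hC2 : ∀ P ⊆ M.E, M.eRk P = 3 → P.ncard ≤ 7 :=
    fun P hP hr => ThmN.ncard_le_seven_of_eRk_three M hs hfree hP hr
  have hS₀E : ⋃₀ PercRepro.Matroid.circuitsLE M 4 ⊆ M.E := sUnion_circuitsLE_subset_ground M 4
  have hS20 : (⋃₀ PercRepro.Matroid.circuitsLE M 4).ncard ≤ 20 := by
    have := Set.ncard_le_ncard hS₀E M.ground_finite
    omega
  have hs₃ : (PercRepro.Matroid.circuitsEq M 3).ncard ≤ 25 := by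
    have h := ThmN.core_ncard_triangles_subset_le_sq M hs hfree hS₀E hd'
    have hsub : PercRepro.Matroid.circuitsEq M 3 ⊆
        {C : Set α | M.IsCircuit C ∧ C.ncard = 3 ∧ C ⊆ ⋃₀ PercRepro.Matroid.circuitsLE M 4} := by
      intro C hC
      exact ⟨hC.1, hC.2, Set.subset_sUnion_of_mem (PercRepro.Matroid.circuitsEq_subset_circuitsLE (by norm_num) hC)⟩
    have hfin : {C : Set α | M.IsCircuit C ∧ C.ncard = 3 ∧ C ⊆ ⋃₀ PercRepro.Matroid.circuitsLE M 4}.Finite :=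
      M.ground_finite.finite_subsets.subset (fun C hC => hC.1.subset_ground)
    calc (PercRepro.Matroid.circuitsEq M 3).ncard ≤ _ := Set.ncard_le_ncard hsub hfin
      _ ≤ d' * d' := h
      _ ≤ 25 := Nat.mul_le_mul hd5 hd5
  have hs₄ : (PercRepro.Matroid.circuitsEq M 4).ncard ≤ 70 :=
    PercRepro.Matroid.ncard_isCircuit_four_le_of_subset_nullity_le_five M hS₀E
      (fun C hC h4 => subset_sUnion_of_mem_circuitsEq_four ⟨hC, h4⟩) hS20
      (by rw [hd']; gcongr; exact_mod_cast hd5)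
  exact rls_of_cellOK6 M p (by omega) hs hC1 hC2 hrank hE hs₃ hs₄
    (table_sparse6 (p + 6) (by omega) (by omega))
/-! ### Case B: `S₀ = E` -/

/-- The cocircuit count at nullity `6`: `#{k-circuits} ≤ C(c, 5) / C(c − k − 5 + 2, 2)`. -/
def lm6 (c k : ℕ) : ℕ := c.choose 5 / (c - k - 5 + 2).choose 2

/-- The count `s · C(c − k − 3, 2) ≤ C(c, 5)` read as the bound `s ≤ lm6 c k`. -/
theorem le_lm6_of_mul_le {s c k : ℕ} (h : s * (c - k - 5 + 2).choose 2 ≤ c.choose 5) : s ≤ lm6 c k := by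
  unfold lm6
  rw [Nat.le_div_iff_mul_le (Nat.choose_pos (by omega))]
  exact h

/-- The dense-case bound on `s₃` at corank `6`: `min 36 (min (lm6 c 3) (C(σ,3) + σ t₂ + t₃))`, `c = σ + t₂ + t₃ + t₄`. -/
def bound3six (σ t₂ t₃ t₄ : ℕ) : ℕ :=
  min 36 (min (lm6 (σ + t₂ + t₃ + t₄) 3) (σ.choose 3 + σ * t₂ + t₃))

/-- The dense-case bound on `s₄` at corank `6`: `min (lm6 c 4) (C(σ,4) + C(σ,2) t₂ + C(t₂,2) + σ t₃ + t₄)`. -/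
def bound4six (σ t₂ t₃ t₄ : ℕ) : ℕ :=
  min (lm6 (σ + t₂ + t₃ + t₄) 4) (σ.choose 4 + σ.choose 2 * t₂ + t₂.choose 2 + σ * t₃ + t₄)

/-- The dense case at corank `6`, `n = 16`: every class-size vector passes (`decide +kernel`). -/
theorem table_dense6_16 : ∀ σ < 17, ∀ t₂ < 9, ∀ t₃ < 6, ∀ t₄ < 5, σ + 2 * t₂ + 3 * t₃ + 4 * t₄ = 16 →
    cellOK6 16 (bound3six σ t₂ t₃ t₄) (bound4six σ t₂ t₃ t₄) = true := by
  decide +kernel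

/-- The dense case at corank `6`, `n = 17` (by `decide +kernel`). -/
theorem table_dense6_17 : ∀ σ < 18, ∀ t₂ < 9, ∀ t₃ < 6, ∀ t₄ < 5, σ + 2 * t₂ + 3 * t₃ + 4 * t₄ = 17 →
    cellOK6 17 (bound3six σ t₂ t₃ t₄) (bound4six σ t₂ t₃ t₄) = true := by
  decide +kernel

/-- The dense case at corank `6`, `n = 18` (by `decide +kernel`). -/
theorem table_dense6_18 : ∀ σ < 19, ∀ t₂ < 10, ∀ t₃ < 7, ∀ t₄ < 5, σ + 2 * t₂ + 3 * t₃ + 4 * t₄ = 18 →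
    cellOK6 18 (bound3six σ t₂ t₃ t₄) (bound4six σ t₂ t₃ t₄) = true := by
  decide +kernel

/-- The three dense tables at corank `6` combined: `16 ≤ n ≤ 18`. -/
theorem table_dense6 (n : ℕ) (hn : 16 ≤ n) (hn' : n ≤ 18) (σ t₂ t₃ t₄ : ℕ)
    (h : σ + 2 * t₂ + 3 * t₃ + 4 * t₄ = n) :
    cellOK6 n (bound3six σ t₂ t₃ t₄) (bound4six σ t₂ t₃ t₄) = true := by
  rcases (show n = 16 ∨ n = 17 ∨ n = 18 by omega) with rfl | rfl | rfl
  · exact table_dense6_16 σ (by omega) t₂ (by omega) t₃ (by omega) t₄ (by omega) h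
  · exact table_dense6_17 σ (by omega) t₂ (by omega) t₃ (by omega) t₄ (by omega) h
  · exact table_dense6_18 σ (by omega) t₂ (by omega) t₃ (by omega) t₄ (by omega) h

/-- **Case B at corank `6`**: `ν(S₀) = 6` ⇒ `S₀ = E`, series classes of `≤ 4` elements, the class bounds pass (`table_dense6`). -/
theorem rls_six_of_dense (M : Matroid α) [M.Finite] (p : ℕ) (hp : 10 ≤ p) (hp' : p ≤ 12)
    (hs : ∀ e ∈ M.E, ∀ f ∈ M.E, e ≠ f → M.eRk {e, f} = 2)
    (hfree : ∀ e ∈ M.E, ∃ A ⊆ M.E \ {e}, e ∉ M.closure A ∧ e ∉ M.closure ((M.E \ {e}) \ A))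
    (hcoloop : ∀ e, ¬ M.IsColoop e) (hrank : M.eRank = (p : ℕ∞)) (hE : M.E.ncard = p + 6)
    (hS₀ : ⋃₀ PercRepro.Matroid.circuitsLE M 4 = M.E) : ThmN.RLS M p 3 := by
  classical
  have hC1 : ∀ L ⊆ M.E, M.eRk L = 2 → L.ncard ≤ 3 :=
    fun L hL hr => ThmN.ncard_le_three_of_eRk_two M hs hfree hL hr
  have hC2 : ∀ P ⊆ M.E, M.eRk P = 3 → P.ncard ≤ 7 :=
    fun P hP hr => ThmN.ncard_le_seven_of_eRk_three M hs hfree hP hr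
  have hd : M.E.encard = M.eRank + 6 := by
    rw [hrank, ← M.ground_finite.cast_ncard_eq, hE]; push_cast; rfl
  have hν : M✶.eRank = 6 := by
    have h := Matroid.eRank_add_eRank_dual M
    rw [hd, hrank] at h
    exact WithTop.add_left_cancel (WithTop.natCast_ne_top p) h
  have hs36 : (PercRepro.Matroid.circuitsEq M 3).ncard ≤ 36 := by
    have h := ThmN.ncard_triangles_le_sq M hC1 hd
    exact h
  obtain ⟨R, hR⟩ := exists_isReps M
  have hRfin : R.Finite := M.ground_finite.subset hR.subset
  set Rf := hRfin.toFinset with hRf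
  set a : α → ℕ := fun r => (M✶.closure {r}).ncard with ha
  have hRc : R.ncard = Rf.card := Set.ncard_eq_toFinset_card _ _
  have h1 : ∀ r ∈ Rf, 1 ≤ a r := by
    intro r hr
    rw [hRf, Set.Finite.mem_toFinset] at hr
    have hfin := cls_finite (M := M) r
    exact Nat.one_le_iff_ne_zero.2 (fun h0 => by
      have := (Set.ncard_eq_zero hfin).1 h0
      exact (Set.eq_empty_iff_forall_notMem.1 this r) (mem_cls_self hR hr))
  have h4 : ∀ r ∈ Rf, a r ≤ 4 := by
    intro r hr
    rw [hRf, Set.Finite.mem_toFinset] at hr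
    have hrE : r ∈ ⋃₀ PercRepro.Matroid.circuitsLE M 4 := by rw [hS₀]; exact hR.subset hr
    obtain ⟨C, hC, hrC⟩ := Set.mem_sUnion.1 hrE
    have hsub := closure_dual_singleton_subset_of_mem_isCircuit hcoloop hC.1 hrC
    have hCfin : C.Finite := M.ground_finite.subset hC.1.subset_ground
    have hC4 : C.ncard ≤ 4 := by
      have := hC.2
      rw [← hCfin.cast_ncard_eq] at this
      exact_mod_cast this
    exact (Set.ncard_le_ncard hsub hCfin).trans hC4
  set σ := (Rf.filter (fun r => a r = 1)).card with hσ
  set t₂ := (Rf.filter (fun r => a r = 2)).card with ht₂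
  set t₃ := (Rf.filter (fun r => a r = 3)).card with ht₃
  set t₄ := (Rf.filter (fun r => a r = 4)).card with ht₄
  have hn : p + 6 = σ + 2 * t₂ + 3 * t₃ + 4 * t₄ := by
    rw [← hE, ncard_ground_eq_sum hcoloop hR hRfin, ← hRf]
    exact sum_eq_of_le_four Rf a h1 h4
  have hc : Rf.card = σ + t₂ + t₃ + t₄ := card_eq_of_le_four Rf a h1 h4
  have hlm3 : (PercRepro.Matroid.circuitsEq M 3).ncard ≤ lm6 (σ + t₂ + t₃ + t₄) 3 := by
    have h := PercRepro.Matroid.ncard_isCircuit_mul_choose_le M hR.subset hR.nonloop hR.cover hR.inj hν 3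
    rw [hRc, hc] at h
    exact le_lm6_of_mul_le h
  have hlm4 : (PercRepro.Matroid.circuitsEq M 4).ncard ≤ lm6 (σ + t₂ + t₃ + t₄) 4 := by
    have h := PercRepro.Matroid.ncard_isCircuit_mul_choose_le M hR.subset hR.nonloop hR.cover hR.inj hν 4
    rw [hRc, hc] at h
    exact le_lm6_of_mul_le h
  have hw3 : (PercRepro.Matroid.circuitsEq M 3).ncard ≤ σ.choose 3 + σ * t₂ + t₃ :=
    (ncard_circuitsEq_le_card_weight hcoloop hR hRfin 3).trans (card_weight_three_le Rf a h1)
  have hw4 : (PercRepro.Matroid.circuitsEq M 4).ncard ≤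
      σ.choose 4 + σ.choose 2 * t₂ + t₂.choose 2 + σ * t₃ + t₄ :=
    (ncard_circuitsEq_le_card_weight hcoloop hR hRfin 4).trans (card_weight_four_le Rf a h1)
  have hs₃ : (PercRepro.Matroid.circuitsEq M 3).ncard ≤ bound3six σ t₂ t₃ t₄ :=
    le_min hs36 (le_min hlm3 hw3)
  have hs₄ : (PercRepro.Matroid.circuitsEq M 4).ncard ≤ bound4six σ t₂ t₃ t₄ := le_min hlm4 hw4
  exact rls_of_cellOK6 M p (by omega) hs hC1 hC2 hrank hE hs₃ hs₄
    (table_dense6 (p + 6) (by omega) (by omega) σ t₂ t₃ t₄ hn.symm)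
/-! ### The cells `10 ≤ p ≤ 12` at corank `6` -/

/-- **C-025 at `(p, 3)` on the coloop-free core at corank `6` for every `10 ≤ p ≤ 12`.** -/
theorem c025_core_six (M : Matroid α) [M.Finite] (p : ℕ) (hp : 10 ≤ p) (hp' : p ≤ 12)
    (hs : ∀ e ∈ M.E, ∀ f ∈ M.E, e ≠ f → M.eRk {e, f} = 2) (hcoloop : ∀ e, ¬ M.IsColoop e)
    (hfree : ∀ e ∈ M.E, ∃ A ⊆ M.E \ {e}, e ∉ M.closure A ∧ e ∉ M.closure ((M.E \ {e}) \ A))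
    (hrank : M.eRank = (p : ℕ∞)) (hE : M.E.ncard = p + 6) : ThmN.RLS M p 3 := by
  have hd : M.E.encard = M.eRank + 6 := by
    rw [hrank, ← M.ground_finite.cast_ncard_eq, hE]; push_cast; rfl
  set S₀ := ⋃₀ PercRepro.Matroid.circuitsLE M 4 with hS₀def
  have hS₀E : S₀ ⊆ M.E := sUnion_circuitsLE_subset_ground M 4
  have hS₀fin : S₀.Finite := M.ground_finite.subset hS₀E
  obtain ⟨r, hr⟩ := exists_eRk_eq_nat (M := M) S₀
  have hrle : r ≤ S₀.ncard := by
    have := M.eRk_le_encard S₀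
    rw [hr, ← hS₀fin.cast_ncard_eq] at this
    exact_mod_cast this
  have hd' : S₀.encard = M.eRk S₀ + ((S₀.ncard - r : ℕ) : ℕ∞) := by
    rw [hr, ← hS₀fin.cast_ncard_eq]
    have : S₀.ncard = r + (S₀.ncard - r) := by omega
    conv_lhs => rw [this]
    push_cast; rfl
  have hmono := encard_le_eRk_add_of_ground hS₀E hd
  rw [hd'] at hmono
  have hle6 : S₀.ncard - r ≤ 6 := by
    have h := (WithTop.add_le_add_iff_left (by rw [hr]; exact WithTop.natCast_ne_top r)).1 hmono
    have h' : ((S₀.ncard - r : ℕ) : ℕ∞) ≤ ((6 : ℕ) : ℕ∞) := h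
    exact_mod_cast h'
  rcases Nat.lt_or_ge (S₀.ncard - r) 6 with hlt | hge
  · exact rls_six_of_nullity_le_five M p hp hp' hs hfree hrank hE hd' (by omega)
  · have h6 : S₀.ncard - r = 6 := by omega
    rw [h6] at hd'
    have hS₀ : S₀ = M.E := eq_ground_of_encard_eq_eRk_add hcoloop hS₀E hd hd'
    exact rls_six_of_dense M p hp hp' hs hfree hcoloop hrank hE hS₀

/-- **The small core cells without corank `4` below `18`, corank `5` below `14`, corank `6` at `10 ≤ p ≤ 12`.** -/
def SmallCoreCellsSeven : Prop :=
  ∀ {α : Type} (M : Matroid α) [M.Finite] (p : ℕ), 5 ≤ p →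
    (∀ e ∈ M.E, ∀ f ∈ M.E, e ≠ f → M.eRk {e, f} = 2) → M.eRank = (p : ℕ∞) →
    (∀ e, ¬ M.IsColoop e) →
    (∀ e ∈ M.E, ∃ A ⊆ M.E \ {e}, e ∉ M.closure A ∧ e ∉ M.closure ((M.E \ {e}) \ A)) →
    ((p = 7 ∨ p = 8) ∨
      (p ≤ 169 ∧ p + 4 ≤ M.E.ncard ∧ M.E.ncard < p + CoreRegimes.amin p ∧
        ¬ (M.E.ncard = p + 4 ∧ 100 ≤ M.E.ncard) ∧ ¬ (M.E.ncard = p + 4 ∧ 9 ≤ p ∧ p ≤ 17) ∧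
        ¬ (M.E.ncard = p + 5 ∧ 9 ≤ p ∧ p ≤ 13) ∧ ¬ (M.E.ncard = p + 6 ∧ 10 ≤ p ∧ p ≤ 12))) →
    ThmN.RLS M p 3

/-- `SmallCoreCellsSeven` implies `SmallCoreCellsSix`: the corank-`6` cells at `10 ≤ p ≤ 12` are `c025_core_six`. -/
theorem smallCoreCellsSix_of_seven (h : SmallCoreCellsSeven) : SmallCoreCellsSix := by
  intro α M _ p hp hs hrank hcoloop hfree hcell
  rcases hcell with h78 | ⟨hp169, hlo, hhi, h100, h4, h5⟩
  · exact h M p hp hs hrank hcoloop hfree (Or.inl h78)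
  · by_cases h6 : M.E.ncard = p + 6 ∧ 10 ≤ p ∧ p ≤ 12
    · exact c025_core_six M p h6.2.1 h6.2.2 hs hcoloop hfree hrank h6.1
    · exact h M p hp hs hrank hcoloop hfree (Or.inr ⟨hp169, hlo, hhi, h100, h4, h5, h6⟩)

/-- **C-025 at `q = 3` for every finite matroid and every `p ≥ 5`, from the cells of `SmallCoreCellsSeven`.** -/
theorem c025_three_of_smallCoreCellsSeven (h : SmallCoreCellsSeven) :
    ∀ {α : Type} (M : Matroid α) [M.Finite] (p : ℕ), 5 ≤ p → ThmN.RLS M p 3 :=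
  c025_three_of_smallCoreCellsSix (smallCoreCellsSix_of_seven h)

end CoreFour
end PercRepro
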